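import Mathlib
import Summits.PneNP.PneNP.Theorems.OverlapGapAlgebraNoStableSectionGlue3
import Summits.PneNP.PneNP.Theorems.OverlapGapAlgebraSearchHardWindowChaosAsymptotics

/-!
# Route OverlapGapAlgebra, crux `SearchHardWindow` (stmt-PneNP-2460), line `Sketch`: the
# parameter asymptotics of the ensemble OGP (Huang–Sellke 2025, Lemma 3.22)

Stub `stub_ogpAsymptotics` of the skeleton
`Summits/PneNP/PneNP/Cruxes/SearchHardWindow/Lines/Sketch.lean` (section `EnsembleOGP`): the pure
real-analysis half of the ensemble overlap-gap property for random `k`-SAT at clause density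
`α_k = 5 · 2^k log k / k`. The first moment of `stub_ogpCore` bounds the mass of the OGP event by
`(K+1)^{k+1} · 2^n ((n+1)^{2^k} e^{nβ})^k · base^m`, `m = ⌊α_k n⌋`, where
`base = 1 − 2^{−k} D`, `D = 1 + k (1 − SB_s(p₀)) − θ k(k+1)/2 − k(k+1)/2 · 2^{−F}`,
`SB_s(p) = 2(1−p)^s + s p (1−p)^{s−1}` and `p₀ = (β − η − 2θ)/(−log θ)`.

We choose `β = 2.65 log k/k`, `η = 0.05 log k/k` (so `β − η = 2.6 log k/k`), `θ = 1/(k log² k)`,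
`F = ⌊log₂ k⌋ + 8` (so `2^F ≥ 128 (k+1)` and `F = O(log k)`), `s = k − F`, exactly the window of the
DartGame line of crux `NoStableSection`, whose estimates we reuse: with `lg = log k ≥ 7`,
`k p₀ ∈ [2.5, 2.6]` (`glue_KA_s`), hence `s p₀ ∈ [2.45, 2.6]` and the small ball
`SB_s(p₀) ≤ 2 e^{−2.45} + 2.6 e^{−2.45}/0.99 ≤ 0.41` (`oga_SB`, as `glue_KA_SB`), so
`0.57 k ≤ D ≤ k + 1` (`oga_numerics`); thus `0 ≤ base ≤ exp (−2^{−k} D)` and the kill exponent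
`α_k 2^{−k} D ≥ 2.85 lg` per `n` beats the count exponent `log 2 + kβ = log 2 + 2.65 lg` by more
than `0.2` (`oga_params`). For fixed `k` the `n`-asymptotics (`oga_nAsymp`, mirror of
`stub_chaosAsymptotics`) absorb the polynomial factors `(K+1)^{k+1} ≤ 2^{k+1} (n+1)^{A(k+1)}` and
`(n+1)^{k 2^k}` by `cha_poly_le_exp`, giving the rate `c = 0.1`. The `k`-asymptotic inputs
(`k ≥ 1200`, `log k/k ≤ 0.001`, `5 log log k ≤ 0.05 log k`) hold eventually (`oga_eventually`).
-/

set_option linter.dupNamespace false -- `Summit.PneNP.PneNP.…`: summit = sub-problem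

namespace Summit.PneNP.PneNP.Theorems

open Finset Filter Topology
open Summit.PneNP.PneNP.Cruxes.NoStableSection.DartGame (glue_log_ge_seven glue_KA_s
  glue_one_sub_pow_le)

/-! ## Fixed `k`: the `n`-asymptotics -/

/-- **The `n`-asymptotics for a fixed `k`**: if `0 ≤ B ≤ e^{-r}` with `r ≥ 0` and the kill rate
`α_k r` exceeds the count rate `log 2 + k β` by `2c > 0`, then
`(K+1)^{k+1} · 2^n ((n+1)^{2^k} e^{nβ})^k · B^{⌊α_k n⌋} ≤ e^{-c n}` for all large `n`, uniformly in
`K ≤ n^A`. -/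
theorem oga_nAsymp {k : ℕ} {β B r c : ℝ} (hB0 : 0 ≤ B) (hBr : B ≤ Real.exp (-r)) (hr : 0 ≤ r)
    (hc : 0 < c) (hgap : Real.log 2 + k * β + 2 * c ≤ 5 * 2 ^ k * Real.log k / k * r) (A : ℕ) :
    ∀ᶠ n : ℕ in atTop, ∀ K : ℕ, K ≤ n ^ A →
      ((K : ℝ) + 1) ^ (k + 1) * ((2 : ℝ) ^ n * (((n : ℝ) + 1) ^ (2 ^ k) * Real.exp (n * β)) ^ k) *
        B ^ ⌊5 * 2 ^ k * Real.log k / k * n⌋₊ ≤ Real.exp (-(c * n)) := by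
  obtain ⟨α, hα⟩ : ∃ α : ℝ, α = 5 * 2 ^ k * Real.log k / k := ⟨_, rfl⟩
  rw [← hα] at hgap ⊢
  filter_upwards [cha_poly_le_exp ((2 : ℝ) ^ (k + 1) * Real.exp r) (A * (k + 1) + k * 2 ^ k) hc]
    with n hn K hK
  have hn0 : (0 : ℝ) ≤ n := Nat.cast_nonneg n
  -- the power of the base: `B^m ≤ e^r · e^{-α r n}`
  have hBm : B ^ ⌊α * n⌋₊ ≤ Real.exp r * Real.exp (-(α * r * n)) := by
    have hm : α * n - 1 < (⌊α * n⌋₊ : ℝ) := Nat.sub_one_lt_floor _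
    have h1 : r * (α * n - 1) ≤ r * ⌊α * n⌋₊ := mul_le_mul_of_nonneg_left hm.le hr
    calc B ^ ⌊α * n⌋₊ ≤ Real.exp (-r) ^ ⌊α * n⌋₊ := pow_le_pow_left₀ hB0 hBr _
      _ = Real.exp (⌊α * n⌋₊ * (-r)) := (Real.exp_nat_mul _ _).symm
      _ ≤ Real.exp (r + -(α * r * n)) := Real.exp_le_exp.2 (by linarith)
      _ = Real.exp r * Real.exp (-(α * r * n)) := Real.exp_add _ _
  -- the time tuples: `K + 1 ≤ 2 (n + 1) ^ A`
  have hKb : (K : ℝ) + 1 ≤ 2 * ((n : ℝ) + 1) ^ A := by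
    have h1 : (K : ℝ) ≤ (n : ℝ) ^ A := by exact_mod_cast hK
    have h2 : (n : ℝ) ^ A ≤ ((n : ℝ) + 1) ^ A := pow_le_pow_left₀ hn0 (by linarith) A
    have h3 : (1 : ℝ) ≤ ((n : ℝ) + 1) ^ A := one_le_pow₀ (by linarith)
    linarith
  have hT : ((K : ℝ) + 1) ^ (k + 1) ≤ (2 * ((n : ℝ) + 1) ^ A) ^ (k + 1) :=
    pow_le_pow_left₀ (by positivity) hKb _
  have h2n : (2 : ℝ) ^ n = Real.exp (n * Real.log 2) := by
    rw [Real.exp_nat_mul, Real.exp_log two_pos]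
  have hek : Real.exp (n * β) ^ k = Real.exp (k * (n * β)) := (Real.exp_nat_mul _ _).symm
  -- assemble
  calc ((K : ℝ) + 1) ^ (k + 1) * ((2 : ℝ) ^ n * (((n : ℝ) + 1) ^ (2 ^ k) * Real.exp (n * β)) ^ k) *
        B ^ ⌊α * n⌋₊
      ≤ (2 * ((n : ℝ) + 1) ^ A) ^ (k + 1) *
          ((2 : ℝ) ^ n * (((n : ℝ) + 1) ^ (2 ^ k) * Real.exp (n * β)) ^ k) *
          (Real.exp r * Real.exp (-(α * r * n))) :=
        mul_le_mul (mul_le_mul_of_nonneg_right hT (by positivity)) hBm (pow_nonneg hB0 _)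
          (by positivity)
    _ = (2 : ℝ) ^ (k + 1) * Real.exp r * ((n : ℝ) + 1) ^ (A * (k + 1) + k * 2 ^ k) *
          ((2 : ℝ) ^ n * Real.exp (n * β) ^ k * Real.exp (-(α * r * n))) := by ring
    _ ≤ Real.exp (c * n) * ((2 : ℝ) ^ n * Real.exp (n * β) ^ k * Real.exp (-(α * r * n))) :=
        mul_le_mul_of_nonneg_right hn (by positivity)
    _ = Real.exp (c * n + (n * Real.log 2 + k * (n * β) + -(α * r * n))) := by
        rw [h2n, hek, ← Real.exp_add, ← Real.exp_add, ← Real.exp_add]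
    _ ≤ Real.exp (-(c * n)) := Real.exp_le_exp.2 (by nlinarith [mul_le_mul_of_nonneg_right hgap hn0])

/-! ## Numerical constants and the small ball with `s` darts -/

/-- `e^{2.45} ≥ 11.4`. -/
theorem oga_exp_two_pt_four_five : (11.4 : ℝ) ≤ Real.exp 2.45 := by
  have h1 : (2.7182818283 : ℝ) < Real.exp 1 := Real.exp_one_gt_d9
  have h2 : (1.55125 : ℝ) ≤ Real.exp 0.45 := by
    have := Real.quadratic_le_exp_of_nonneg (show (0 : ℝ) ≤ 0.45 by norm_num)
    norm_num at this ⊢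
    linarith
  have he : Real.exp 2.45 = Real.exp 1 * Real.exp 1 * Real.exp 0.45 := by
    rw [← Real.exp_add, ← Real.exp_add]; norm_num
  rw [he]
  have h0 : (0 : ℝ) ≤ Real.exp 1 := Real.exp_nonneg 1
  nlinarith [mul_le_mul h1.le h1.le (by norm_num) h0, Real.exp_nonneg (0.45 : ℝ)]

/-- The binomial-extremality small ball with `s` darts at the window: if `s p₀ ∈ [2.45, 2.6]` and
`0 ≤ p₀ ≤ 0.01` then `SB_s(p₀) = 2(1-p₀)^s + s p₀ (1-p₀)^{s-1} ≤ 0.41` (as `glue_KA_SB`). -/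
theorem oga_SB {s : ℕ} {S p₀ : ℝ} (hs1 : 1 ≤ s) (hS : S = s) (hs_le : S * p₀ ≤ 2.6)
    (hs_ge : 2.45 ≤ S * p₀) (hp0 : 0 ≤ p₀) (hp1 : p₀ ≤ 0.01) :
    2 * (1 - p₀) ^ s + S * p₀ * (1 - p₀) ^ (s - 1) ≤ 0.41 := by
  have hp₀lt : p₀ < 1 := by linarith
  have hpow : (1 - p₀) ^ s ≤ Real.exp (-(S * p₀)) := by
    have := glue_one_sub_pow_le hp0 hp₀lt.le s
    rw [← hS, mul_comm] at this
    exact this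
  have hexp : Real.exp (-(S * p₀)) ≤ Real.exp (-2.45) := Real.exp_le_exp.2 (by linarith)
  have he : Real.exp (-2.45) ≤ 1 / 11.4 := by
    rw [Real.exp_neg, one_div]
    exact inv_anti₀ (by norm_num) oga_exp_two_pt_four_five
  have hq : (1 - p₀) ^ s = (1 - p₀) ^ (s - 1) * (1 - p₀) := by
    rw [← pow_succ, Nat.sub_add_cancel hs1]
  have h1p : 0 < 1 - p₀ := by linarith
  have hpow1 : (1 - p₀) ^ (s - 1) ≤ Real.exp (-2.45) / (1 - p₀) := by
    rw [le_div_iff₀ h1p, ← hq]; exact hpow.trans hexp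
  have hpow1' : (1 - p₀) ^ (s - 1) ≤ (1 / 11.4) / 0.99 := by
    refine hpow1.trans ?_
    calc Real.exp (-2.45) / (1 - p₀) ≤ (1 / 11.4) / (1 - p₀) :=
          div_le_div_of_nonneg_right he h1p.le
      _ ≤ (1 / 11.4) / 0.99 := div_le_div_of_nonneg_left (by norm_num) (by norm_num) (by linarith)
  have hA : 2 * (1 - p₀) ^ s ≤ 2 * (1 / 11.4) := by linarith [hpow.trans (hexp.trans he)]
  have hB : S * p₀ * (1 - p₀) ^ (s - 1) ≤ 2.6 * ((1 / 11.4) / 0.99) :=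
    mul_le_mul hs_le hpow1' (pow_nonneg h1p.le _) (by norm_num)
  have : 2 * (1 / 11.4 : ℝ) + 2.6 * ((1 / 11.4) / 0.99) ≤ 0.41 := by norm_num
  linarith

/-! ## The `k`-dependent estimates at the chosen parameters -/

/-- **The numerics at the window** (`K = k ≥ 1200`, `lg = log k`, `lg/K ≤ 0.001`,
`5 log lg ≤ 0.05 lg`; `β = 2.65 lg/K`, `η = 0.05 lg/K`, `θ = 1/(K lg²)`, `F = ⌊log₂ k⌋ + 8`,
`s = k - F`, `p₀ = (β - η - 2θ)/(-log θ)`): the side conditions, and the slot exponent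
`D = 1 + K(1 - SB_s(p₀)) - θ K(K+1)/2 - K(K+1)/2 · 2^{-F}` satisfies `0.57 K ≤ D ≤ K + 1`. -/
theorem oga_numerics {k s F : ℕ} {K lg β η θ p₀ : ℝ} (hK : K = k) (hlg : lg = Real.log K)
    (hk : 1200 ≤ k) (hE3 : lg / K ≤ 0.001) (hL3 : 5 * Real.log lg ≤ 0.05 * lg)
    (hβ : β = 2.65 * (lg / K)) (hη : η = 0.05 * (lg / K)) (hθ : θ = 1 / (K * lg ^ 2))
    (hF : F = Nat.log 2 k + 8) (hs : s = k - F) (hp₀ : p₀ = (β - η - 2 * θ) / (-Real.log θ)) :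
    0 < η ∧ η < β ∧ β < 5 * lg / K ∧ 0 < θ ∧ θ < 1 ∧ 2 * θ ≤ β - η ∧ s + F ≤ k ∧
    0.57 * K ≤ ((1 : ℝ) + K * (1 - (2 * (1 - p₀) ^ s + s * p₀ * (1 - p₀) ^ (s - 1))) -
      θ * (K * (K + 1) / 2)) - K * (K + 1) / 2 * (1 / 2 : ℝ) ^ F ∧
    ((1 : ℝ) + K * (1 - (2 * (1 - p₀) ^ s + s * p₀ * (1 - p₀) ^ (s - 1))) -
      θ * (K * (K + 1) / 2)) - K * (K + 1) / 2 * (1 / 2 : ℝ) ^ F ≤ K + 1 := by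
  have hkr : (1200 : ℝ) ≤ K := by rw [hK]; exact_mod_cast hk
  have hK0 : (0 : ℝ) < K := by linarith only [hkr]
  have hKne : K ≠ 0 := hK0.ne'
  have hlg7 : 7 ≤ lg := by rw [hlg, hK]; exact glue_log_ge_seven hk
  have hlg0 : 0 < lg := by linarith only [hlg7]
  have hlgne : lg ≠ 0 := hlg0.ne'
  have hlgK0 : 0 < lg / K := div_pos hlg0 hK0
  have hlg2 : (49 : ℝ) ≤ lg ^ 2 := by nlinarith only [hlg7]
  -- `F`: `128 (K + 1) ≤ 2^F`, `F ≤ 1.45 lg + 8 ≤ 0.0082 K`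
  have h2F : 128 * (k + 1) ≤ 2 ^ F := by
    have h := Nat.lt_pow_succ_log_self Nat.one_lt_two k
    rw [pow_succ] at h
    have e : 2 ^ F = 2 ^ Nat.log 2 k * 256 := by rw [hF, pow_add]; norm_num
    rw [e]; omega
  have h2F' : 128 * (K + 1) ≤ (2 : ℝ) ^ F := by rw [hK]; exact_mod_cast h2F
  have hFlg : (F : ℝ) ≤ 1.45 * lg + 8 := by
    have h := Nat.pow_log_le_self 2 (show k ≠ 0 by omega)
    have h' : (2 : ℝ) ^ Nat.log 2 k ≤ K := by rw [hK]; exact_mod_cast h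
    have h'' : (Nat.log 2 k : ℝ) * Real.log 2 ≤ lg := by
      rw [hlg, ← Real.log_pow]; exact Real.log_le_log (by positivity) h'
    have hl2 : (0.6931471803 : ℝ) < Real.log 2 := Real.log_two_gt_d9
    have hF' : (F : ℝ) = Nat.log 2 k + 8 := by rw [hF]; push_cast; ring
    rw [hF']
    nlinarith [mul_le_mul_of_nonneg_left hl2.le (Nat.cast_nonneg (Nat.log 2 k)),
      Nat.cast_nonneg (α := ℝ) (Nat.log 2 k)]
  have hFK : (F : ℝ) ≤ 0.0082 * K := by
    have : lg ≤ 0.001 * K := by rwa [div_le_iff₀ hK0] at hE3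
    linarith only [this, hFlg, hkr]
  have hFk : F ≤ k := by
    have h : (F : ℝ) ≤ (k : ℝ) := by rw [← hK]; linarith only [hFK, hkr]
    exact_mod_cast h
  have hFk' : F < k := by
    have h : (F : ℝ) < (k : ℝ) := by rw [← hK]; linarith only [hFK, hkr]
    exact_mod_cast h
  have hF0 : (0 : ℝ) ≤ F := Nat.cast_nonneg F
  -- `s`
  have hs1 : 1 ≤ s := by rw [hs]; omega
  have hsF : s + F ≤ k := by rw [hs]; omega
  have hsR : (s : ℝ) = K - F := by rw [hs, Nat.cast_sub hFk, hK]
  -- `θ`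
  have hKlg : 0 < K * lg ^ 2 := by positivity
  have hθ0 : 0 < θ := by rw [hθ]; positivity
  have hθ1 : θ < 1 := by
    rw [hθ, div_lt_one hKlg]; nlinarith only [hkr, hlg2]
  have hloglg : 0 ≤ Real.log lg := Real.log_nonneg (by linarith only [hlg7])
  have htpos : 0 < lg + 2 * Real.log lg := by linarith only [hlg0, hloglg]
  have hlogθ : -Real.log θ = lg + 2 * Real.log lg := by
    rw [hθ, one_div, Real.log_inv, neg_neg, Real.log_mul hKne (by positivity), Real.log_pow, ← hlg]
    push_cast; ring
  have hbη : β - η = 2.6 * (lg / K) := by rw [hβ, hη]; ring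
  have h2θ : 2 * θ ≤ β - η := by
    rw [hbη, hθ, show 2 * (1 / (K * lg ^ 2)) = (2 / lg ^ 2) * (1 / K) by field_simp,
      show 2.6 * (lg / K) = (2.6 * lg) * (1 / K) by ring]
    refine mul_le_mul_of_nonneg_right ?_ (by positivity)
    rw [div_le_iff₀ (by positivity)]; nlinarith only [hlg7]
  -- `p₀`: `K p₀ ∈ [2.5, 2.6]`, `p₀ ∈ [0, 0.01]`, `s p₀ ∈ [2.45, 2.6]`
  have hKp : K * p₀ = (2.6 * lg - 2 * (1 / lg ^ 2)) / (lg + 2 * Real.log lg) := by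
    rw [hp₀, hlogθ, hbη, hθ]
    field_simp
  obtain ⟨hs_ge, hs_le⟩ : 2.5 ≤ K * p₀ ∧ K * p₀ ≤ 2.6 := by
    rw [hKp]; exact glue_KA_s hlg7 hL3
  have hp₀0 : 0 ≤ p₀ := by
    by_contra h
    have : K * p₀ < 0 := mul_neg_of_pos_of_neg hK0 (lt_of_not_ge h)
    linarith only [this, hs_ge]
  have hp₀1 : p₀ ≤ 0.01 := by
    by_contra h
    have h' : 0.01 < p₀ := lt_of_not_ge h
    have : K * 0.01 < K * p₀ := mul_lt_mul_of_pos_left h' hK0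
    linarith only [this, hs_le, hkr]
  have h1p : 0 ≤ 1 - p₀ := by linarith only [hp₀1]
  have hSle : (s : ℝ) * p₀ ≤ 2.6 := by
    rw [hsR]; nlinarith only [hs_le, mul_nonneg hF0 hp₀0]
  have hSge : 2.45 ≤ (s : ℝ) * p₀ := by
    rw [hsR]; nlinarith only [hs_ge, hs_le, mul_le_mul_of_nonneg_right hFK hp₀0]
  -- the small ball, the truncation term and the freshness penalty
  set SB : ℝ := 2 * (1 - p₀) ^ s + s * p₀ * (1 - p₀) ^ (s - 1) with hSBdef
  have hSB : SB ≤ 0.41 := oga_SB hs1 rfl hSle hSge hp₀0 hp₀1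
  have hSB0 : 0 ≤ SB := add_nonneg (mul_nonneg zero_le_two (pow_nonneg h1p _))
    (mul_nonneg (mul_nonneg (Nat.cast_nonneg _) hp₀0) (pow_nonneg h1p _))
  have hθt : θ * (K * (K + 1) / 2) ≤ (K + 1) / 2 * (1 / 49) := by
    have e : θ * (K * (K + 1) / 2) = (K + 1) / 2 * (1 / lg ^ 2) := by rw [hθ]; field_simp
    rw [e]
    exact mul_le_mul_of_nonneg_left (div_le_div_of_nonneg_left zero_le_one (by norm_num) hlg2)
      (by linarith only [hkr])
  have hθt0 : 0 ≤ θ * (K * (K + 1) / 2) := by positivity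
  have hpen : K * (K + 1) / 2 * (1 / 2 : ℝ) ^ F ≤ K / 256 := by
    have h : (1 / 2 : ℝ) ^ F ≤ 1 / (128 * (K + 1)) := by
      rw [one_div_pow]
      exact div_le_div_of_nonneg_left zero_le_one (by positivity) h2F'
    calc K * (K + 1) / 2 * (1 / 2 : ℝ) ^ F ≤ K * (K + 1) / 2 * (1 / (128 * (K + 1))) :=
          mul_le_mul_of_nonneg_left h (by positivity)
      _ = K / 256 := by field_simp; ring
  have hpen0 : 0 ≤ K * (K + 1) / 2 * (1 / 2 : ℝ) ^ F := by positivity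
  refine ⟨by rw [hη]; positivity, by rw [hβ, hη]; exact mul_lt_mul_of_pos_right (by norm_num) hlgK0,
    ?_, hθ0, hθ1, h2θ, hsF, ?_, ?_⟩
  · rw [hβ, show (5 : ℝ) * lg / K = 5 * (lg / K) by ring]
    exact mul_lt_mul_of_pos_right (by norm_num) hlgK0
  · have h1 : K * 0.59 ≤ K * (1 - SB) := mul_le_mul_of_nonneg_left (by linarith only [hSB]) hK0.le
    linarith only [h1, hθt, hpen, hkr]
  · have h1 : K * (1 - SB) ≤ K := by nlinarith only [hSB0, hK0]
    linarith only [h1, hθt0, hpen0]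

/-- **The estimates at the chosen parameters, for one large `k`**: the body of
`stub_ogpAsymptotics` for `β = 2.65 log k/k`, `η = 0.05 log k/k`, `θ = 1/(k log² k)`,
`F = ⌊log₂ k⌋ + 8`, `s = k - F`, with rate `c = 0.1`. -/
theorem oga_params {k : ℕ} (hk : 1200 ≤ k) (hE3 : Real.log k / k ≤ 0.001)
    (hL3 : 5 * Real.log (Real.log k) ≤ 0.05 * Real.log k) {β η θ : ℝ} {s F : ℕ}
    (hβ : β = 2.65 * (Real.log k / k)) (hη : η = 0.05 * (Real.log k / k))
    (hθ : θ = 1 / (k * Real.log k ^ 2)) (hF : F = Nat.log 2 k + 8) (hs : s = k - F) :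
    0 < η ∧ η < β ∧ β < 5 * Real.log k / k ∧
      0 < θ ∧ θ < 1 ∧ 2 * θ ≤ β - η ∧ s + F ≤ k ∧
      0 ≤ (1 - (1 / 2 : ℝ) ^ k * (((1 : ℝ) + k * (1 - (2 * (1 - (β - η - 2 * θ) / (-Real.log θ)) ^ s + s * ((β - η - 2 * θ) / (-Real.log θ)) * (1 - (β - η - 2 * θ) / (-Real.log θ)) ^ (s - 1))) - θ * ((k : ℝ) * (k + 1) / 2)) - (k : ℝ) * (k + 1) / 2 * (1 / 2 : ℝ) ^ F)) ∧
      ∀ A : ℕ, ∃ c : ℝ, 0 < c ∧ ∀ᶠ n : ℕ in atTop, ∀ K : ℕ, K ≤ n ^ A →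
        ((K : ℝ) + 1) ^ (k + 1) * ((2 : ℝ) ^ n * (((n : ℝ) + 1) ^ (2 ^ k) * Real.exp (n * β)) ^ k) *
          (1 - (1 / 2 : ℝ) ^ k * (((1 : ℝ) + k * (1 - (2 * (1 - (β - η - 2 * θ) / (-Real.log θ)) ^ s + s * ((β - η - 2 * θ) / (-Real.log θ)) * (1 - (β - η - 2 * θ) / (-Real.log θ)) ^ (s - 1))) - θ * ((k : ℝ) * (k + 1) / 2)) - (k : ℝ) * (k + 1) / 2 * (1 / 2 : ℝ) ^ F)) ^ ⌊5 * 2 ^ k * Real.log k / k * n⌋₊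
          ≤ Real.exp (-(c * n)) := by
  obtain ⟨hη0, hηβ, hβ5, hθ0, hθ1, h2θ, hsF, hDge, hDle⟩ :=
    oga_numerics rfl rfl hk hE3 hL3 hβ hη hθ hF hs rfl
  set D : ℝ := ((1 : ℝ) + k * (1 - (2 * (1 - (β - η - 2 * θ) / (-Real.log θ)) ^ s +
    s * ((β - η - 2 * θ) / (-Real.log θ)) * (1 - (β - η - 2 * θ) / (-Real.log θ)) ^ (s - 1))) -
    θ * ((k : ℝ) * (k + 1) / 2)) - (k : ℝ) * (k + 1) / 2 * (1 / 2 : ℝ) ^ F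
  have hkr : (1200 : ℝ) ≤ k := by exact_mod_cast hk
  have hk0 : (0 : ℝ) < k := by linarith only [hkr]
  have hkne : (k : ℝ) ≠ 0 := hk0.ne'
  have hhalf0 : (0 : ℝ) ≤ (1 / 2 : ℝ) ^ k := by positivity
  have hX0 : 0 ≤ (1 / 2 : ℝ) ^ k * D := mul_nonneg hhalf0 (by linarith only [hDge, hkr])
  have hX1 : (1 / 2 : ℝ) ^ k * D ≤ 1 := by
    have h2k : (k : ℝ) + 1 ≤ (2 : ℝ) ^ k := by
      exact_mod_cast Nat.succ_le_of_lt Nat.lt_two_pow_self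
    calc (1 / 2 : ℝ) ^ k * D ≤ (1 / 2 : ℝ) ^ k * 2 ^ k :=
          mul_le_mul_of_nonneg_left (hDle.trans h2k) hhalf0
      _ = 1 := by rw [← mul_pow]; norm_num
  have hbase0 : 0 ≤ 1 - (1 / 2 : ℝ) ^ k * D := by linarith only [hX1]
  have hbexp : 1 - (1 / 2 : ℝ) ^ k * D ≤ Real.exp (-((1 / 2 : ℝ) ^ k * D)) := by
    linarith only [Real.add_one_le_exp (-((1 / 2 : ℝ) ^ k * D))]
  have hgap : Real.log 2 + k * β + 2 * 0.1 ≤ 5 * 2 ^ k * Real.log k / k * ((1 / 2 : ℝ) ^ k * D) := by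
    have hone : (2 : ℝ) ^ k * (1 / 2 : ℝ) ^ k = 1 := by rw [← mul_pow]; norm_num
    have e : 5 * 2 ^ k * Real.log k / k * ((1 / 2 : ℝ) ^ k * D) =
        5 * (Real.log k / k) * D * ((2 : ℝ) ^ k * (1 / 2 : ℝ) ^ k) := by ring
    rw [e, hone, mul_one]
    have h1 : 5 * (Real.log k / k) * (0.57 * k) ≤ 5 * (Real.log k / k) * D :=
      mul_le_mul_of_nonneg_left hDge (by positivity)
    have h2 : 5 * (Real.log k / k) * (0.57 * k) = 2.85 * Real.log k := by field_simp; ring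
    have h3 : (k : ℝ) * β = 2.65 * Real.log k := by rw [hβ]; field_simp
    have hlg7 : (7 : ℝ) ≤ Real.log k := glue_log_ge_seven hk
    have hl2 : Real.log 2 < 0.6931471808 := Real.log_two_lt_d9
    linarith only [h1, h2, h3, hlg7, hl2]
  exact ⟨hη0, hηβ, hβ5, hθ0, hθ1, h2θ, hsF, hbase0, fun A =>
    ⟨0.1, by norm_num, oga_nAsymp hbase0 hbexp hX0 (by norm_num) hgap A⟩⟩

/-- The `k`-asymptotic inputs hold for every large `k`: `k ≥ 1200` (so `log k ≥ 7`),
`log k / k ≤ 0.001` and `5 log log k ≤ 0.05 log k`. -/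
theorem oga_eventually : ∀ᶠ k : ℕ in atTop,
    1200 ≤ k ∧ Real.log k / k ≤ 0.001 ∧ 5 * Real.log (Real.log k) ≤ 0.05 * Real.log k := by
  have L1 : Tendsto (fun k : ℕ => Real.log k / k) atTop (𝓝 0) := by
    have h := Real.tendsto_pow_log_div_mul_add_atTop 1 0 1 one_ne_zero
    have h' : Tendsto (fun x : ℝ => Real.log x / x) atTop (𝓝 0) := by
      simpa using h
    exact h'.comp tendsto_natCast_atTop_atTop
  have L3 : ∀ᶠ k : ℕ in atTop, 5 * Real.log (Real.log k) ≤ 0.05 * Real.log k := by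
    have hlo : ∀ᶠ x : ℝ in atTop, ‖Real.log x‖ ≤ 0.01 * ‖x‖ :=
      Real.isLittleO_log_id_atTop.bound (by norm_num)
    have ht : Tendsto (fun k : ℕ => Real.log k) atTop atTop :=
      Real.tendsto_log_atTop.comp tendsto_natCast_atTop_atTop
    have := ht.eventually hlo
    filter_upwards [this, eventually_ge_atTop 3] with k hk hk3
    have hk3' : (3 : ℝ) ≤ k := by exact_mod_cast hk3
    have hlogpos : 0 < Real.log k := Real.log_pos (by linarith)
    simp only [Real.norm_eq_abs, abs_of_pos hlogpos] at hk
    have := (le_abs_self _).trans hk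
    linarith
  filter_upwards [eventually_ge_atTop 1200,
    L1.eventually (ge_mem_nhds (by norm_num : (0 : ℝ) < 0.001)), L3] with k h1 h2 h3
  exact ⟨h1, h2, h3⟩

/-- **Stub `stub_ogpAsymptotics`** (registered on stmt-PneNP-2460, line `Sketch`, section
`EnsembleOGP`): the parameter asymptotics of the ensemble OGP (Huang–Sellke 2025, Lemma 3.22;
real analysis only). For every large `k` there are a band `[β − η, β]` below `5 log k/k`, a
truncation level `θ ∈ (0,1)` with `2θ ≤ β − η`, a dart count `s` and a freshness threshold `F` with
`s + F ≤ k`, such that the slot base is in `[0, 1]` and the first-moment bound of `stub_ogpCore` is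
`≤ e^{−cn}` eventually in `n`, uniformly in the chain length `K ≤ n^A`. -/
theorem stub_ogpAsymptotics :
    ∃ k₀ : ℕ, ∀ k : ℕ, k₀ ≤ k → ∃ (β η θ : ℝ) (s F : ℕ), 0 < η ∧ η < β ∧ β < 5 * Real.log k / k ∧
      0 < θ ∧ θ < 1 ∧ 2 * θ ≤ β - η ∧ s + F ≤ k ∧
      0 ≤ (1 - (1 / 2 : ℝ) ^ k * (((1 : ℝ) + k * (1 - (2 * (1 - (β - η - 2 * θ) / (-Real.log θ)) ^ s + s * ((β - η - 2 * θ) / (-Real.log θ)) * (1 - (β - η - 2 * θ) / (-Real.log θ)) ^ (s - 1))) - θ * ((k : ℝ) * (k + 1) / 2)) - (k : ℝ) * (k + 1) / 2 * (1 / 2 : ℝ) ^ F)) ∧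
      ∀ A : ℕ, ∃ c : ℝ, 0 < c ∧ ∀ᶠ n : ℕ in atTop, ∀ K : ℕ, K ≤ n ^ A →
        ((K : ℝ) + 1) ^ (k + 1) * ((2 : ℝ) ^ n * (((n : ℝ) + 1) ^ (2 ^ k) * Real.exp (n * β)) ^ k) *
          (1 - (1 / 2 : ℝ) ^ k * (((1 : ℝ) + k * (1 - (2 * (1 - (β - η - 2 * θ) / (-Real.log θ)) ^ s + s * ((β - η - 2 * θ) / (-Real.log θ)) * (1 - (β - η - 2 * θ) / (-Real.log θ)) ^ (s - 1))) - θ * ((k : ℝ) * (k + 1) / 2)) - (k : ℝ) * (k + 1) / 2 * (1 / 2 : ℝ) ^ F)) ^ ⌊5 * 2 ^ k * Real.log k / k * n⌋₊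
          ≤ Real.exp (-(c * n)) := by
  obtain ⟨k₀, hk₀⟩ := Filter.eventually_atTop.1 oga_eventually
  refine ⟨k₀, fun k hk => ?_⟩
  obtain ⟨h1, h2, h3⟩ := hk₀ k hk
  exact ⟨_, _, _, _, _, oga_params h1 h2 h3 rfl rfl rfl rfl rfl⟩

end Summit.PneNP.PneNP.Theorems
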